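import Literature.Analysis.Complex.RectangleResidueDoublePoles
import Mathlib.MeasureTheory.Integral.IntegralEqImproper
import HarnessLib

/-!
# Residue theorem between two vertical lines: infinitely many poles, heights along a sequence

Trunk T-ANALYSIS support (`Literature/Analysis/Complex`). The tree moves vertical lines of
integration past *no* poles (`Literature.Analysis.Complex.integral_vertical_eq_of_differentiableOn`)
and past *finitely many simple* poles in a horizontal strip
(`Literature.Analysis.Complex.integral_horizontal_sub_eq_sum_of_simplePoles`). Explicit formulae
over the zeros of `ζ` need the version with **infinitely many poles** (all the zeros between the two
lines), of order `≤ 2`, where the truncating horizontal segments can only be taken at special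
("good") heights `±T_n → ∞` on which the integrand is small. This file proves it:

* `Literature.Analysis.Complex.integral_vertical_sub_eq_tsum_of_doublePoles` — let `a < b`, `P` a set
  of points of the open strip `a < re z < b` meeting every horizontal strip `|im z| ≤ M` in a finite
  set, `F` analytic at every point of the closed strip off `P`, with a pole of order `≤ 2` at each
  `p ∈ P` in the concrete sense `F = φ_p/(z−p)²` near `p` (`φ_p` differentiable near `p`,
  `φ_p'(p) = r(p)`), `∑_{p ∈ P} r(p)` summable, `F` integrable along `re z = a` and `re z = b`, and
  suppose there are heights `T_n → +∞`, none of them (nor `−T_n`) the ordinate of a pole, with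
  `sup_{x ∈ [a,b]} ‖F(x ± iT_n)‖ → 0`. Then
  `i∫ F(b+iy) dy − i∫ F(a+iy) dy = 2πi ∑'_{p ∈ P} r(p)`.

Proof: the residue theorem on `[a,b] × [−T_n, T_n]`
(`Literature.Analysis.Complex.rectBoundaryIntegral_eq_sum_of_doublePoles`) and `n → ∞`: the
horizontal sides are `≤ (b−a)·sup → 0`, the vertical sides tend to the line integrals
(`MeasureTheory.intervalIntegral_tendsto_integral`), and the finite sums of residues over the poles
with `|im p| < T_n` tend to the sum of the summable family (these finite sets are eventually above
any given finite set of poles).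

Standard textbook move (Titchmarsh, *The Theory of the Riemann Zeta-Function*, §3.12 and §14.27;
Davenport, *Multiplicative Number Theory*, Ch. 17); tagged folklore.
-/

noncomputable section

open Complex Set MeasureTheory Filter intervalIntegral
open _root_.Topology

namespace Literature.Analysis.Complex

/-- **Residue theorem between two vertical lines, infinitely many poles of order `≤ 2`, along a
sequence of good heights.** See the module docstring. In the conclusion the lines are parametrised
by `y ↦ x + iy`, so that `∫_{(x)} F(s) ds = i∫ F(x+iy) dy`; the right-hand side is `2πi` times the
(unconditionally convergent) sum of the residues `r(p) = φ_p'(p)`. [folklore] -/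
theorem integral_vertical_sub_eq_tsum_of_doublePoles {F : ℂ → ℂ} {a b : ℝ} (hab : a < b)
    (P : Set ℂ) (r : ℂ → ℂ)
    (hP : ∀ p ∈ P, a < p.re ∧ p.re < b)
    (hfin : ∀ M : ℝ, {p ∈ P | |p.im| ≤ M}.Finite)
    (han : ∀ z : ℂ, a ≤ z.re → z.re ≤ b → z ∉ P → AnalyticAt ℂ F z)
    (hpole : ∀ p ∈ P, ∃ φ : ℂ → ℂ, ∃ V ∈ 𝓝 p, DifferentiableOn ℂ φ V ∧ deriv φ p = r p ∧
        ∀ z ∈ V, z ≠ p → F z = φ z / (z - p) ^ 2)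
    (hsum : Summable fun p : P ↦ r p)
    (ha : Integrable fun y : ℝ ↦ F (a + y * I)) (hb : Integrable fun y : ℝ ↦ F (b + y * I))
    (T δ : ℕ → ℝ) (hT : Tendsto T atTop atTop) (hδ : Tendsto δ atTop (𝓝 0))
    (hTP : ∀ n, ∀ p ∈ P, |p.im| ≠ T n)
    (hdecay : ∀ n, ∀ x ∈ Icc a b, ‖F (x + T n * I)‖ ≤ δ n ∧ ‖F (x - T n * I)‖ ≤ δ n) :
    I * (∫ y : ℝ, F (b + y * I)) - I * (∫ y : ℝ, F (a + y * I)) =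
      2 * Real.pi * I * ∑' p : P, r p := by
  classical
  -- pole data as functions
  choose! φ V hV hφ hφ' hFφ using hpole
  -- the finite pole sets below height `T n`
  have hfin' : ∀ n, {p ∈ P | |p.im| < T n}.Finite := fun n ↦
    (hfin (T n)).subset fun p hp ↦ ⟨hp.1, hp.2.le⟩
  set S : ℕ → Finset ℂ := fun n ↦ (hfin' n).toFinset with hSdef
  have hS : ∀ n p, p ∈ S n ↔ p ∈ P ∧ |p.im| < T n := fun n p ↦ by
    simp [hSdef]
  -- the rectangle identity for `T n > 0`
  have hrect : ∀ n, 0 < T n →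
      rectBoundaryIntegral F a b (-T n) (T n) = 2 * Real.pi * I * ∑ p ∈ S n, r p := by
    intro n hn
    set U : Set ℂ := {z | AnalyticAt ℂ F z} ∪ ⋃ p ∈ S n, interior (V p) with hU
    have hUo : IsOpen U :=
      (isOpen_analyticAt ℂ F).union (isOpen_biUnion fun p _ ↦ isOpen_interior)
    refine rectBoundaryIntegral_eq_sum_of_doublePoles hab (by linarith) (S n) F r U hUo ?_ ?_ ?_ ?_
    · -- the closed rectangle lies in `U`
      intro z hz
      rw [mem_reProdIm] at hz
      by_cases hzP : z ∈ P
      · have hzS : z ∈ S n := by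
          rw [hS]
          refine ⟨hzP, lt_of_le_of_ne (abs_le.2 ⟨by linarith [hz.2.1], hz.2.2⟩) (hTP n z hzP)⟩
        refine Or.inr (mem_iUnion₂.2 ⟨z, hzS, ?_⟩)
        exact mem_interior_iff_mem_nhds.2 (hV z hzP)
      · exact Or.inl (han z hz.1.1 hz.1.2 hzP)
    · intro p hp
      have hp' := (hS n p).1 hp
      rw [mem_reProdIm]
      exact ⟨hP p hp'.1, abs_lt.1 hp'.2⟩
    · intro z hz
      have hzS : z ∉ S n := by simpa using hz.2
      rcases hz.1 with h | h
      · exact h.differentiableAt.differentiableWithinAt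
      · obtain ⟨p, hp, hzp⟩ := mem_iUnion₂.1 h
        have hpP : p ∈ P := ((hS n p).1 hp).1
        have hne : z ≠ p := fun h ↦ hzS (h ▸ hp)
        have hVz : V p ∈ 𝓝 z := Filter.mem_of_superset (isOpen_interior.mem_nhds hzp) interior_subset
        have h1 : DifferentiableAt ℂ (φ p) z := (hφ p hpP).differentiableAt hVz
        have h2 : DifferentiableAt ℂ (fun w ↦ φ p w / (w - p) ^ 2) z :=
          h1.div ((differentiableAt_id.sub_const p).pow 2) (pow_ne_zero 2 (sub_ne_zero.2 hne))
        refine (h2.congr_of_eventuallyEq ?_).differentiableWithinAt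
        filter_upwards [hVz, isOpen_ne.mem_nhds hne] with w hw hwp using hFφ p hpP w hw hwp
    · intro p hp
      have hpP : p ∈ P := ((hS n p).1 hp).1
      exact ⟨φ p, V p, hV p hpP, hφ p hpP, hφ' p hpP, hFφ p hpP⟩
  -- continuity of `F` on the good horizontal segments
  have hcontH : ∀ n, ∀ x ∈ Icc a b, ∀ y : ℝ, |y| = T n → ContinuousAt F (x + y * I) := by
    intro n x hx y hy
    have hzP : ((x : ℂ) + y * I) ∉ P := fun h ↦ hTP n _ h (by simpa using hy)
    exact (han _ (by simpa using hx.1) (by simpa using hx.2) hzP).continuousAt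
  -- the horizontal sides tend to zero
  have hab' : a ≤ b := hab.le
  have hhor : ∀ (sgn : ℝ), (sgn = 1 ∨ sgn = -1) →
      Tendsto (fun n ↦ ∫ x in a..b, F (x + ((sgn * T n : ℝ) : ℂ) * I)) atTop (𝓝 0) := by
    intro sgn hsgn
    rw [tendsto_zero_iff_norm_tendsto_zero]
    have hbound : ∀ n, ‖∫ x in a..b, F (x + ((sgn * T n : ℝ) : ℂ) * I)‖ ≤ |δ n| * |b - a| := by
      intro n
      refine intervalIntegral.norm_integral_le_of_norm_le_const fun x hx ↦ ?_
      rw [uIoc_of_le hab'] at hx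
      have hx' : x ∈ Icc a b := ⟨hx.1.le, hx.2⟩
      rcases hsgn with rfl | rfl
      · have := (hdecay n x hx').1
        simp only [one_mul] at *
        exact this.trans (le_abs_self _)
      · have := (hdecay n x hx').2
        have e : (x : ℂ) + ((-1 * T n : ℝ) : ℂ) * I = x - T n * I := by push_cast; ring
        rw [e]
        exact this.trans (le_abs_self _)
    have hlim : Tendsto (fun n ↦ |δ n| * |b - a|) atTop (𝓝 0) := by
      have := (continuous_abs.tendsto 0).comp hδ
      simpa using this.mul_const |b - a|
    exact squeeze_zero (fun n ↦ norm_nonneg _) hbound hlim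
  have htop : Tendsto (fun n ↦ ∫ x in a..b, F (x + T n * I)) atTop (𝓝 0) := by
    have := hhor 1 (Or.inl rfl)
    simpa using this
  have hbot : Tendsto (fun n ↦ ∫ x in a..b, F (x + ((-T n : ℝ) : ℂ) * I)) atTop (𝓝 0) := by
    have := hhor (-1) (Or.inr rfl)
    simpa using this
  -- the vertical sides tend to the line integrals
  have hneg : Tendsto (fun n ↦ -T n) atTop atBot := tendsto_neg_atTop_atBot.comp hT
  have hright : Tendsto (fun n ↦ ∫ y in (-T n)..T n, F (b + y * I)) atTop
      (𝓝 (∫ y : ℝ, F (b + y * I))) := intervalIntegral_tendsto_integral hb hneg hT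
  have hleft : Tendsto (fun n ↦ ∫ y in (-T n)..T n, F (a + y * I)) atTop
      (𝓝 (∫ y : ℝ, F (a + y * I))) := intervalIntegral_tendsto_integral ha hneg hT
  -- the finite sums of residues tend to the full sum
  set u : ℕ → Finset P := fun n ↦ (S n).subtype (· ∈ P) with hudef
  have hu_sum : ∀ n, ∑ q ∈ u n, r (q : ℂ) = ∑ p ∈ S n, r p := by
    intro n
    rw [hudef, Finset.sum_subtype_eq_sum_filter]
    congr 1
    exact Finset.filter_true_of_mem fun p hp ↦ ((hS n p).1 hp).1
  have hu : Tendsto u atTop atTop := by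
    rw [tendsto_atTop]
    intro s₀
    have : ∀ q ∈ s₀, ∀ᶠ n in atTop, q ∈ u n := by
      intro q _
      filter_upwards [hT.eventually_gt_atTop |(q : ℂ).im|] with n hn
      simp only [hudef, Finset.mem_subtype, hS]
      exact ⟨q.2, hn⟩
    filter_upwards [(s₀.eventually_all).2 this] with n hn
    exact fun q hq ↦ hn q hq
  have hres : Tendsto (fun n ↦ ∑ p ∈ S n, r p) atTop (𝓝 (∑' p : P, r p)) := by
    have h := hsum.hasSum.comp hu
    refine h.congr fun n ↦ ?_
    simp only [Function.comp]
    exact hu_sum n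
  -- assemble: both sides of the rectangle identity converge
  have hev : ∀ᶠ n in atTop, rectBoundaryIntegral F a b (-T n) (T n) =
      2 * Real.pi * I * ∑ p ∈ S n, r p := by
    filter_upwards [hT.eventually_gt_atTop 0] with n hn using hrect n hn
  have hL : Tendsto (fun n ↦ rectBoundaryIntegral F a b (-T n) (T n)) atTop
      (𝓝 (0 - 0 + I * (∫ y : ℝ, F (b + y * I)) - I * (∫ y : ℝ, F (a + y * I)))) := by
    simp only [rectBoundaryIntegral_def]
    have hbot' : Tendsto (fun n ↦ ∫ x in a..b, F (x + ↑(-T n) * I)) atTop (𝓝 0) := by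
      refine hbot.congr fun n ↦ ?_
      norm_cast
    exact ((hbot'.sub htop).add (hright.const_mul I)).sub (hleft.const_mul I)
  have hR : Tendsto (fun n ↦ 2 * Real.pi * I * ∑ p ∈ S n, r p) atTop
      (𝓝 (2 * Real.pi * I * ∑' p : P, r p)) := hres.const_mul _
  have := tendsto_nhds_unique (hL.congr' hev) hR
  simpa using this

end Literature.Analysis.Complex

end
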